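import Summits.QuantumFields.YangMills.Theorems.BalabanUVNodesN15KingModelGaussNormDeterminant
import Summits.QuantumFields.YangMills.Theorems.BalabanUVNodesN15KingModelBlockCovarianceIdentity
import HarnessLib

/-!
# BalabanUVNodes ∕ N15 — THE KING-MODEL RUNG (PART Ε-q): THE RG DETERMINANT IDENTITY `det A₀ · det Δ^{(K)} = a^{|Ω|} · det B` — the determinants of King's fine
# fluctuation operator `A₀ = B + aQ*Q`, his effective Laplacian `Δ^{(K)} = a − a²N^dQA₀⁻¹Qᵀ` and the free fine operator `B = N²(−Δ)+m²` are tied by the matrix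
# determinant lemma; hence `det A₀ = Π_{p∈T̂_η}lapSym(p)·Π_{q∈Ω̂}(1 + aS(q))` and the Gaussian bookkeeping `𝒩(A₀)·𝒩(Δ^{(K)}) = 𝒩(B)·√(2π∕a)^{|Ω|}` behind (2.4)–(2.6)
# (Track A, DAG node N15 = NE2; FAN-OUT v1.1 §N15 s3 «KING-MODEL RUNG»; companion of parts Ϛ, Ε-k, Ε-n, Ε-p; count-neutral)

HONEST FRAMING.  Count-neutral (cell `pub-ymgap`, seat `pub-ymgap-dag-n15-e` g40; `--supports stmt-QuantumFields-27366 --as helper` = K3⁸).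
TEMPLATE LITERATURE: C. King, Commun. Math. Phys. **102** (1986) 649–677 [King1986], (2.4)–(2.6) p.652 (the renormalization transformation `T(ψ,φ) ∝ exp(−½a|ψ − Qφ|²)`
integrated against `exp(−½⟨φ,Bφ⟩)`: «exp E₀» collects the Gaussian constants), (2.13)–(2.16) p.653 (`A₀`, `Δ^{(k)}`, `C^{(k)} = a_k⁻¹ + QGQ*`), (3.89) p.668.  The tree has:
`fineOp N M a c m² = lapF + a·blockProj` (`A₀`), `QᵀQ = N^{−d}·blockProj` (`transpose_Qmat_mul_Qmat`), `effLaplacian = a·1 − (a²N^d)·QA₀⁻¹Qᵀ` ((2.14)), part Ϛ's ★★★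
covariance identity `(Δ^{(K)})⁻¹ = a⁻¹·1 + N^d·QB⁻¹Qᵀ` (`effLaplacian_inv_eq_noise_add_blockAvg`, `c = N²`), part Ε-k `det B = Π_p lapSym(p)`, part Ε-n `det Δ^{(K)} =
Π_q a∕(1+aS(q))`, part Ε-p `𝒩(Δ) = √(2π)^n∕√det Δ` for symmetric coercive `Δ`.  THIS FILE: §1 `fineOp_eq_lapF_add_smul` (`A₀ = B + (aN^d)·QᵀQ`); ★★★
**`det_fineOp_mul_det_effLaplacian`** — `det A₀ · det Δ^{(K)} = a^{|Ω|}·det B` (`A₀ = B(1 + B⁻¹(aN^d)Qᵀ·Q)`, Mathlib's `Matrix.det_one_add_mul_comm` moves `Q` to the front,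
and `1 + (aN^d)QB⁻¹Qᵀ = a·(Δ^{(K)})⁻¹` is part Ϛ); §2 ★★ **`det_fineOp_eq_prod`** — `det A₀ = Π_{p∈T̂_η} lapSym(p) · Π_{q∈Ω̂}(1 + aS(q))` (the fine free determinant times the
fibrewise factors `1 + aS(q)` of King's alias sums), `det_fineOp_pos`; §3 ★★★ **`gaussNorm_fineOp_mul_gaussNorm_effLaplacian`** — `𝒩(A₀)·𝒩(Δ^{(K)}) = 𝒩(B)·√(2π∕a)^{|Ω|}`:
integrating King's Gaussian `exp(−½a N^d|ψ−Qφ|²_{Ω} − ½⟨φ,Bφ⟩)` first in `ψ` (mass `√(2π∕a)^{|Ω|}` per the unit-lattice normalisation, then `𝒩(B)`) or first in `φ` (`𝒩(A₀)`, leaving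
`exp(−½⟨ψ,Δ^{(K)}ψ⟩)`, then `𝒩(Δ^{(K)})`) gives the same number — here obtained from the determinants, not from Fubini; ★★ **`log_gaussNorm_effLaplacian_eq_fine`** (`ln N_K =
ln 𝒩(B) − ln 𝒩(A₀) + ½|Ω|·ln(2π∕a)`).

PRIOR TREE ART (used, not restated): `King1986.EffectiveLaplacianSymbol` (`fineOp`, `fineOp_coercive`, `fineOp_transpose`, `Qmat`, `transpose_Qmat_mul_Qmat`, `effLaplacian`, `effSym`,
`Sfib`, `Sfib_nonneg`, `lapF_coercive`, `lapF_comm`), `King1986.CovarianceSplitting` (`effLaplacian_coercive_of_nonneg`), part Ϛ (`effLaplacian_inv_eq_noise_add_blockAvg`), part Ϡ-g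
(`effLaplacian_transpose_eq`), parts Ε-k (`det_lapF_eq_prod_lapSym`, `det_lapF_pos`), Ε-n (`det_effLaplacian_eq_prod_effSym`, `det_effLaplacian_pos`), Ε-p (`gaussNorm_eq_det`), part Τ-a
(`gaussNorm`, `gaussNorm_pos`), pv17 `QGQInverse` (`Coercive`, `isUnit_of_coercive`), Mathlib (`Matrix.det_one_add_mul_comm`, `det_smul`, `det_nonsing_inv`).  NOT Bałaban's covariant
objects; NOT a node discharge (N15 is booked through n15-a's knit, untouched); nothing continuum-YM ∕ `ℝ⁴` ∕ OS ∕ Clay.  0 `sorry`, 0 `def`.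

HONEST SCOPE.  King's `A = 0` free model on unit tori `Π_μℤ∕M_μ` (dimension `d+1`) with `N ≥ 1` fine sites per block side, King's scaling `c = N² = η⁻²`, `a > 0`, `m² > 0`; the
Fubini reading of §3 is an interpretation (the theorem is the determinant identity read through part Ε-p).  Locators: [King1986] (2.4)–(2.6) p.652, (2.13)–(2.16) p.653, (3.89) p.668.
-/

noncomputable section

open scoped BigOperators
open Finset Matrix

namespace Summit.QuantumFields.YangMills.BalabanUVNodes.N15KingModelRung.TorusSpectral

open Literature.MathematicalPhysics.QuantumFieldTheory.Balaban1983to89.QGQInverse (Coercive isUnit_of_coercive)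
open Literature.MathematicalPhysics.QuantumFieldTheory.Balaban1983to89.B5Prop11Plancherel (Tor fine)
open Literature.MathematicalPhysics.QuantumFieldTheory.King1986.Torus
open Summit.QuantumFields.YangMills.BalabanUVNodes.N15KingModelRung.FreeField (gaussNorm gaussNorm_pos)

variable {d : ℕ} (N : ℕ) [NeZero N] (M : Fin (d + 1) → ℕ) [hM : ∀ μ, NeZero (M μ)]

/-! ## §1 The RG determinant identity -/

/-- `A₀ = B + (aN^{d+1})·QᵀQ` (the tree's `fineOp = lapF + a·blockProj` with `QᵀQ = N^{−(d+1)}·blockProj`). [cite: King1986, (2.13) p.653] -/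
theorem fineOp_eq_lapF_add_smul (a c m2 : ℝ) :
    fineOp N M a c m2 = lapF (fine N M) c m2 + (a * (N : ℝ) ^ (d + 1)) • ((Qmat N M)ᵀ * Qmat N M) := by
  have hN : ((N : ℝ) ^ (d + 1)) ≠ 0 := pow_ne_zero _ (by exact_mod_cast NeZero.ne N)
  rw [fineOp, transpose_Qmat_mul_Qmat, smul_smul, mul_inv_cancel_right₀ hN]

/-- ★★★ **THE RG DETERMINANT IDENTITY**: `det A₀ · det Δ^{(K)} = a^{|Ω|} · det B` for King's fine fluctuation operator `A₀ = B + aQ*Q`, effective Laplacian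
`Δ^{(K)} = a − a²N^dQA₀⁻¹Qᵀ` and free fine operator `B = N²(−Δ)+m²` (every unit torus, `N ≥ 1`, `c = N²`, `a > 0`, `m² > 0`) — the matrix determinant lemma `det(1+XQ) = det(1+QX)`
and part Ϛ's `1 + (aN^d)QB⁻¹Qᵀ = a·(Δ^{(K)})⁻¹`. [cite: King1986, (2.4)–(2.6) p.652, (2.13)–(2.16) p.653] -/
theorem det_fineOp_mul_det_effLaplacian (hN1 : 1 ≤ N) {a m2 : ℝ} (ha : 0 < a) (hm : 0 < m2) :
    (fineOp N M a ((N : ℝ) ^ 2) m2).det * (effLaplacian N M a ((N : ℝ) ^ 2) m2).det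
      = a ^ Fintype.card (Tor M) * (lapF (fine N M) ((N : ℝ) ^ 2) m2).det := by
  have hBunit : IsUnit (lapF (fine N M) ((N : ℝ) ^ 2) m2).det :=
    (Matrix.isUnit_iff_isUnit_det _).mp (isUnit_of_coercive hm (lapF_coercive (fine N M) ((N : ℝ) ^ 2) m2 (by positivity)))
  have hΔdet : (effLaplacian N M a ((N : ℝ) ^ 2) m2).det ≠ 0 := (det_effLaplacian_pos N M ha (by positivity) hm).ne'
  -- `A₀ = B·(1 + B⁻¹(aN^{d+1})Qᵀ·Q)`
  have hA0 : fineOp N M a ((N : ℝ) ^ 2) m2 = lapF (fine N M) ((N : ℝ) ^ 2) m2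
      * (1 + (lapF (fine N M) ((N : ℝ) ^ 2) m2)⁻¹ * ((a * (N : ℝ) ^ (d + 1)) • (Qmat N M)ᵀ) * Qmat N M) := by
    rw [Matrix.mul_add, Matrix.mul_one, ← Matrix.mul_assoc, ← Matrix.mul_assoc, Matrix.mul_nonsing_inv _ hBunit, Matrix.one_mul, Matrix.smul_mul,
      fineOp_eq_lapF_add_smul]
  -- part Ϛ: `1 + Q·(B⁻¹(aN^{d+1})Qᵀ) = a·(Δ^{(K)})⁻¹`
  have hcov : 1 + Qmat N M * ((lapF (fine N M) ((N : ℝ) ^ 2) m2)⁻¹ * ((a * (N : ℝ) ^ (d + 1)) • (Qmat N M)ᵀ))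
      = a • (effLaplacian N M a ((N : ℝ) ^ 2) m2)⁻¹ := by
    rw [effLaplacian_inv_eq_noise_add_blockAvg N M hN1 ha hm, smul_add, smul_smul, mul_inv_cancel₀ ha.ne', one_smul, smul_smul, Matrix.mul_smul,
      Matrix.mul_smul, Matrix.mul_assoc]
  rw [hA0, Matrix.det_mul, Matrix.det_one_add_mul_comm, hcov, Matrix.det_smul, Matrix.det_nonsing_inv, Ring.inverse_eq_inv, mul_assoc, mul_assoc,
    inv_mul_cancel₀ hΔdet, mul_one, mul_comm]

/-! ## §2 The fine fluctuation determinant in closed form -/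

/-- ★★ **`det A₀ = Π_{p∈T̂_η} lapSym(p) · Π_{q∈Ω̂}(1 + aS(q))`** — the fine free determinant (part Ε-k) times the fibrewise factors of King's alias sums (part Ε-n:
`det Δ^{(K)} = Π_q a∕(1+aS(q))`). [cite: King1986, (2.13) p.653, (4.4)–(4.5) p.670] -/
theorem det_fineOp_eq_prod (hN1 : 1 ≤ N) {a m2 : ℝ} (ha : 0 < a) (hm : 0 < m2) :
    (fineOp N M a ((N : ℝ) ^ 2) m2).det
      = (∏ p : Tor (fine N M), lapSym (fine N M) ((N : ℝ) ^ 2) m2 p) * ∏ q : Tor M, (1 + a * Sfib N M ((N : ℝ) ^ 2) m2 q) := by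
  have h := det_fineOp_mul_det_effLaplacian N M hN1 ha hm
  have hD := det_effLaplacian_eq_prod_effSym N M ha.le (by positivity : (0 : ℝ) ≤ (N : ℝ) ^ 2) hm
  have han : a ^ Fintype.card (Tor M) ≠ 0 := pow_ne_zero _ ha.ne'
  have hprod : (∏ q : Tor M, effSym N M a ((N : ℝ) ^ 2) m2 q) * ∏ q : Tor M, (1 + a * Sfib N M ((N : ℝ) ^ 2) m2 q) = a ^ Fintype.card (Tor M) := by
    rw [← Finset.prod_mul_distrib, ← Finset.card_univ, ← Finset.prod_const]
    refine Finset.prod_congr rfl fun q _ => ?_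
    have hS := Sfib_nonneg (N := N) (M := M) (by positivity : (0 : ℝ) ≤ (N : ℝ) ^ 2) hm q
    have h1 : 1 + a * Sfib N M ((N : ℝ) ^ 2) m2 q ≠ 0 := by positivity
    unfold effSym
    exact div_mul_cancel₀ a h1
  rw [← det_lapF_eq_prod_lapSym]
  calc (fineOp N M a ((N : ℝ) ^ 2) m2).det
      = (fineOp N M a ((N : ℝ) ^ 2) m2).det * (effLaplacian N M a ((N : ℝ) ^ 2) m2).det * (∏ q : Tor M, (1 + a * Sfib N M ((N : ℝ) ^ 2) m2 q))
          / a ^ Fintype.card (Tor M) := by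
        rw [mul_assoc, hD, hprod, mul_div_cancel_right₀ _ han]
    _ = (lapF (fine N M) ((N : ℝ) ^ 2) m2).det * ∏ q : Tor M, (1 + a * Sfib N M ((N : ℝ) ^ 2) m2 q) := by
        rw [h, mul_assoc, mul_div_cancel_left₀ _ han]

/-- `det A₀ > 0`. [folklore] -/
theorem det_fineOp_pos (hN1 : 1 ≤ N) {a m2 : ℝ} (ha : 0 < a) (hm : 0 < m2) : 0 < (fineOp N M a ((N : ℝ) ^ 2) m2).det := by
  rw [det_fineOp_eq_prod N M hN1 ha hm]
  refine mul_pos (Finset.prod_pos fun p _ => lt_of_lt_of_le hm (lapSym_ge (fine N M) _ m2 (by positivity) p)) (Finset.prod_pos fun q _ => ?_)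
  have hS := Sfib_nonneg (N := N) (M := M) (by positivity : (0 : ℝ) ≤ (N : ℝ) ^ 2) hm q
  positivity

/-! ## §3 The Gaussian bookkeeping behind King's (2.4)–(2.6) -/

/-- ★★★ **`𝒩(A₀)·𝒩(Δ^{(K)}) = 𝒩(B)·√(2π∕a)^{|Ω|}`** — the Gaussian masses of King's renormalization step computed in either order agree: integrating
`exp(−½aN^d|ψ−Qφ|² − ½⟨φ,Bφ⟩)` first in `φ` gives `𝒩(A₀)·exp(−½⟨ψ,Δ^{(K)}ψ⟩)`, first in `ψ` gives `√(2π∕a)^{|Ω|}·exp(−½⟨φ,Bφ⟩)` (here: the determinant identity read through part Ε-p).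
[cite: King1986, (2.4)–(2.6) p.652, (2.13)–(2.15) p.653, (3.89) p.668] -/
theorem gaussNorm_fineOp_mul_gaussNorm_effLaplacian (hN1 : 1 ≤ N) {a m2 : ℝ} (ha : 0 < a) (hm : 0 < m2) :
    gaussNorm (fineOp N M a ((N : ℝ) ^ 2) m2) * gaussNorm (effLaplacian N M a ((N : ℝ) ^ 2) m2)
      = gaussNorm (lapF (fine N M) ((N : ℝ) ^ 2) m2) * Real.sqrt (2 * Real.pi / a) ^ Fintype.card (Tor M) := by
  have hc : (0 : ℝ) ≤ (N : ℝ) ^ 2 := by positivity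
  have hBsymm : (lapF (fine N M) ((N : ℝ) ^ 2) m2)ᵀ = lapF (fine N M) ((N : ℝ) ^ 2) m2 := by
    ext z z'
    rw [Matrix.transpose_apply]
    exact lapF_comm (fine N M) _ m2 z z'
  rw [gaussNorm_eq_det (fineOp_transpose N M a _ m2) hm (fineOp_coercive N M m2 ha.le hc),
    gaussNorm_eq_det (effLaplacian_transpose_eq N M a _ m2) (by positivity : (0 : ℝ) < (a⁻¹ + m2⁻¹)⁻¹) (effLaplacian_coercive_of_nonneg N M ha hc hm),
    gaussNorm_eq_det hBsymm hm (lapF_coercive (fine N M) _ m2 hc)]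
  have hdA := det_fineOp_pos N M hN1 ha hm
  have hsq : Real.sqrt (fineOp N M a ((N : ℝ) ^ 2) m2).det * Real.sqrt (effLaplacian N M a ((N : ℝ) ^ 2) m2).det
      = Real.sqrt a ^ Fintype.card (Tor M) * Real.sqrt (lapF (fine N M) ((N : ℝ) ^ 2) m2).det := by
    have hpow : Real.sqrt (a ^ Fintype.card (Tor M)) = Real.sqrt a ^ Fintype.card (Tor M) := by
      rw [show a ^ Fintype.card (Tor M) = (Real.sqrt a ^ Fintype.card (Tor M)) ^ 2 by rw [← pow_mul, mul_comm, pow_mul, Real.sq_sqrt ha.le],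
        Real.sqrt_sq (pow_nonneg (Real.sqrt_nonneg _) _)]
    rw [← Real.sqrt_mul hdA.le, det_fineOp_mul_det_effLaplacian N M hN1 ha hm, Real.sqrt_mul (pow_nonneg ha.le _), hpow]
  rw [Real.sqrt_div (by positivity : (0 : ℝ) ≤ 2 * Real.pi) a, div_pow, div_mul_div_comm, div_mul_div_comm, hsq, ← pow_add,
    mul_comm (Real.sqrt a ^ Fintype.card (Tor M))]

/-- ★★ **`ln N_K = ln 𝒩(B) − ln 𝒩(A₀) + ½|Ω|·ln(2π∕a)`** — King's «exp E₀» bookkeeping for the block-field normalisation. [cite: King1986, (2.6) p.652, (2.15) p.653, (3.89) p.668] -/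
theorem log_gaussNorm_effLaplacian_eq_fine (hN1 : 1 ≤ N) {a m2 : ℝ} (ha : 0 < a) (hm : 0 < m2) :
    Real.log (gaussNorm (effLaplacian N M a ((N : ℝ) ^ 2) m2))
      = Real.log (gaussNorm (lapF (fine N M) ((N : ℝ) ^ 2) m2)) - Real.log (gaussNorm (fineOp N M a ((N : ℝ) ^ 2) m2))
        + (Fintype.card (Tor M) : ℝ) / 2 * Real.log (2 * Real.pi / a) := by
  have hc : (0 : ℝ) ≤ (N : ℝ) ^ 2 := by positivity
  have hA := gaussNorm_pos hm (fineOp_coercive N M m2 ha.le hc)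
  have hΔ := gaussNorm_pos (by positivity : (0 : ℝ) < (a⁻¹ + m2⁻¹)⁻¹) (effLaplacian_coercive_of_nonneg N M ha hc hm)
  have hB := gaussNorm_pos hm (lapF_coercive (fine N M) ((N : ℝ) ^ 2) m2 hc)
  have h2πa : 0 < 2 * Real.pi / a := by positivity
  have h := congrArg Real.log (gaussNorm_fineOp_mul_gaussNorm_effLaplacian N M hN1 ha hm)
  rw [Real.log_mul hA.ne' hΔ.ne', Real.log_mul hB.ne' (pow_pos (Real.sqrt_pos.mpr h2πa) _).ne', Real.log_pow, Real.log_sqrt h2πa.le] at h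
  rw [show ∀ x : ℝ, (Fintype.card (Tor M) : ℝ) / 2 * x = (Fintype.card (Tor M) : ℕ) * (x / 2) from fun x => by ring]
  linarith

end Summit.QuantumFields.YangMills.BalabanUVNodes.N15KingModelRung.TorusSpectral

end
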